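import Mathlib
import Literature.Combinatorics.Games.ParityGame
import HarnessLib

/-!
# Mean-payoff games: threshold winning in positional strategies

Topic `Literature/Combinatorics/Games`. A *mean-payoff game* (Ehrenfeucht–Mycielski 1979;
Zwick–Paterson 1996) is played on a finite directed graph whose vertices are split between two
players, Max and Min, with a weight on every edge; the owner of the current vertex moves a token
along an outgoing edge, forever, and Max receives (Min pays) the long-run average of the weights
traversed. Both players have *positional* (memoryless) optimal strategies
(Ehrenfeucht–Mycielski; textbook account: Fijalkow et al., *Games on Graphs*, Ch. 4), and once
both players fix positional strategies `σ`, `τ` the play from `v` is a *lasso* — a simple path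
followed by a simple cycle repeated forever — whose mean payoff is the mean weight of that cycle
(ibid., § "Mean payoff games", proof of Cor. "Limit superior and limit inferior mean payoff
games").

The positional layer — `positionalPlay o σ τ` (successor map of a pair of positional
strategies), `lassoCycle o σ τ v` (the vertex set of the cycle of the lasso from `v`),
`infinitelyOften`, strategies with memory — is the one of the sibling file
`Literature/Combinatorics/Games/ParityGame.lean` (imported; same owner convention `o u = true` =
first player = Max here, Even there). This file adds:

* `mem_infinitelyOften_iterate_iff`, `mem_lassoCycle_iff_exists_period` — the combinatorial
  description of the lasso cycle (forward orbit ∩ periodic points) and `card_lassoCycle_pos`;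
* `MeanPayoffGame.MaxWinsThresholdPositional o w E v θ` — Max has a positional strategy, legal
  for the edge relation `E` at Max's vertices, such that against every legal positional
  strategy of Min the lasso cycle `C` from `v` has mean weight `≥ θ`, written division-free as
  `θ · |C| ≤ ∑_{u ∈ C} w u (f u)` (`f = positionalPlay o σ τ`; the edges of the cycle are the
  `(u, f u)`, `u ∈ C`); `MeanPayoffGame.MinWinsThresholdPositional` — the dual strict form;
  `MaxWinsThresholdPositional.mono` (monotone in Max's edges, antitone in Min's edges, monotone in
  the weights, antitone in the threshold) and `MaxWinsThresholdPositional.not_minWins`;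
* the monotone Boolean encoding used in circuit complexity — inputs
  `x : (V × V) ⊕ (V × Fin k) → Bool`: one bit per ordered pair ("edge present" at Max's vertices,
  "edge absent" at Min's, i.e. `ParityGame.edgeOfBits` on the `Sum.inl` part) and `k` binary
  digits per vertex weight: `MeanPayoffGame.bitEdge`, `bitWeight`, `WinBits`, the Boolean
  function `winFn o v θ` ("MPGWIN") with `winFn_monotone`, and `winBits_two_pow_iff` /
  `winFn_eq_fin` spelling it out literally for `V = Fin n`, `k = n`, threshold `2^(n-1)` — the
  term inlined by route PneNP/PositionalGames (`MpgGeneralSuperpoly`, `MpgMonotoneSuperpoly`,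
  `MpgNoMonotoneGap`, `MpgHardNpLanguage`) before this definition existed, so that those items
  restate over `winFn` by `simp only [winFn_eq_fin]` (checked in a scratch file against verbatim
  copies of the route decls);
* one NAMED FACT (not proved here): `MeanPayoffGame.EhrenfeuchtMycielski1979_thresholdDichotomy`
  — positional determinacy in the threshold/positional form: on a dead-end-free finite arena
  with integer weights, for every integer threshold one of `MaxWinsThresholdPositional`,
  `MinWinsThresholdPositional` holds ("at most one" is the proved `not_minWins`).

Design choices. Arenas are plain data as in `ParityGame.lean` — owner map `o : V → Bool`, edge
relation `E : V → V → Prop` on a `Fintype`, global legality of positional strategies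
`∀ u, o u = true → E u (σ u)` — plus edge weights `w : V → V → R` (vertex weights: take
`fun u _ => w u`) in any ordered semiring `R` (`ℕ`, `ℤ`, `ℚ`, `ℝ`). Mean payoff `≥ θ` of the
lasso cycle is stated multiplied out (`θ · |C| ≤ ∑`), so no division or `liminf` is needed; the
cycle is never empty (`lassoCycle_nonempty`). Decidability under `open scoped Classical`, as in
the route file and in `ParityGame.lean`.

Deliberately NOT here: the `limsup/liminf` mean-payoff objectives of infinite plays under
strategies with memory and the value `val(v)` as a number (the named fact is therefore stated as
the positional corollary of the printed theorem, see its docstring); complexity statements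
(Zwick–Paterson's pseudo-polynomial value iteration, membership in NP ∩ coNP / UP ∩ coUP), which
need an encoding of games as languages; Jurdziński's parity-to-mean-payoff reduction (its key
inequality is proved in `ParityToMeanPayoff.lean`).

## References

* A. Ehrenfeucht, J. Mycielski, *Positional strategies for mean payoff games*, Int. J. Game
  Theory 8 (1979) 109–113, doi:10.1007/bf01768705. [EhrenfeuchtMycielski1979]
* U. Zwick, M. Paterson, *The complexity of mean payoff games on graphs*, Theoret. Comput. Sci.
  158 (1996) 343–359, doi:10.1016/0304-3975(95)00188-3. [ZwickPaterson1996]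
* N. Fijalkow et al., *Games on Graphs*, arXiv:2305.10546 (2023), Ch. 1 § "Memory" (positional
  strategies, positional determinacy) and Ch. 4 (N. Fijalkow, B. Monmege, *Games with Payoffs*),
  § "Proving positional determinacy over finite arenas", Cor. "Positional determinacy of mean
  payoff"; § "Mean payoff games", Cor. "Limit superior and limit inferior mean payoff games".
  [FijalkowEtAl2023GamesOnGraphs]
-/

namespace Literature.Combinatorics.Games

open Finset Filter Function

open scoped Classical

universe u

variable {V : Type u}

/-! ### More on the lasso cycle -/

section Lasso

variable [Fintype V]

/-- Combinatorial description of the vertices visited infinitely often by an orbit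
`t ↦ f^[t] v` on a finite type: `u` is one of them iff `u` is on the forward orbit of `v` and is
a periodic point of `f` (the orbit is ultimately periodic and these are the vertices of its
cycle). [folklore] -/
theorem mem_infinitelyOften_iterate_iff {f : V → V} {v u : V} :
    u ∈ infinitelyOften (fun t => f^[t] v) ↔
      (∃ t : ℕ, f^[t] v = u) ∧ ∃ p : ℕ, 0 < p ∧ f^[p] u = u := by
  rw [mem_infinitelyOften, Filter.frequently_atTop]
  constructor
  · intro h
    obtain ⟨t₁, -, h₁⟩ := h 0
    obtain ⟨t₂, ht₂, h₂⟩ := h (t₁ + 1)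
    refine ⟨⟨t₁, h₁⟩, t₂ - t₁, by omega, ?_⟩
    have key : f^[t₂ - t₁] (f^[t₁] v) = f^[t₂] v := by
      rw [← Function.iterate_add_apply, Nat.sub_add_cancel (by omega)]
    calc f^[t₂ - t₁] u = f^[t₂ - t₁] (f^[t₁] v) := by rw [h₁]
      _ = f^[t₂] v := key
      _ = u := h₂
  · rintro ⟨⟨t, ht⟩, p, hp, hpu⟩ a
    have key : ∀ k : ℕ, f^[k * p] u = u := by
      intro k
      induction k with
      | zero => simp
      | succ k ih => rw [Nat.succ_mul, Function.iterate_add_apply, hpu, ih]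
    refine ⟨a * p + t, ?_, ?_⟩
    · calc a = a * 1 := (mul_one a).symm
        _ ≤ a * p := Nat.mul_le_mul_left a hp
        _ ≤ a * p + t := Nat.le_add_right _ _
    · rw [Function.iterate_add_apply, ht, key]

/-- The lasso cycle of a pair of positional strategies, combinatorially: `u` lies on it iff `u`
is reached from `v` by the positional play and is a periodic point of it. [folklore] -/
theorem mem_lassoCycle_iff_exists_period {o : V → Bool} {σ τ : V → V} {v u : V} :
    u ∈ lassoCycle o σ τ v ↔
      (∃ t : ℕ, (positionalPlay o σ τ)^[t] v = u) ∧
        ∃ p : ℕ, 0 < p ∧ (positionalPlay o σ τ)^[p] u = u := by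
  rw [lassoCycle_eq_infinitelyOften]
  exact mem_infinitelyOften_iterate_iff

/-- The lasso cycle has positive size (averages over it are genuine means). [folklore] -/
theorem card_lassoCycle_pos (o : V → Bool) (σ τ : V → V) (v : V) :
    0 < (lassoCycle o σ τ v).card :=
  Finset.card_pos.2 (lassoCycle_nonempty o σ τ v)

end Lasso

/-! ### Threshold mean-payoff games in positional strategies -/

namespace MeanPayoffGame

variable [Fintype V] {R : Type*}

/-- **Max wins the mean-payoff threshold game from `v`, positionally.** Data: owners
`o : V → Bool` (`true` = Max), edge weights `w`, edge relation `E`, start vertex `v`, threshold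
`θ`. Meaning: there is a positional strategy `σ` of Max using only edges of `E` at Max's vertices
such that for every positional strategy `τ` of Min using only edges of `E` at Min's vertices, the
cycle `C = lassoCycle o σ τ v` of the lasso from `v` has mean weight at least `θ`, stated
division-free: `θ · |C| ≤ ∑_{u ∈ C} w u (f u)` with `f = positionalPlay o σ τ` (the edges of the
cycle are the `(u, f u)`, `u ∈ C`). Since the mean payoff of the lasso play is the mean weight of
its cycle and mean-payoff games have positional optimal strategies, on a dead-end-free arena this
is the statement `value(v) ≥ θ` of the threshold problem (see
`EhrenfeuchtMycielski1979_thresholdDichotomy`); on arbitrary `E` it is the raw `∃σ ∀τ` form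
(no legal `σ` at all if some Max vertex is a dead end; vacuous `∀ τ` if some Min vertex is).
[cite: FijalkowEtAl2023GamesOnGraphs, Ch. 1 § "Memory" (positional strategies) and Ch. 4 § "Mean payoff games" (threshold problem, lasso plays); originally EhrenfeuchtMycielski1979, ZwickPaterson1996] -/
def MaxWinsThresholdPositional [Semiring R] [LE R] (o : V → Bool) (w : V → V → R)
    (E : V → V → Prop) (v : V) (θ : R) : Prop :=
  ∃ σ : V → V, (∀ u, o u = true → E u (σ u)) ∧ ∀ τ : V → V, (∀ u, o u = false → E u (τ u)) →
    θ * ((lassoCycle o σ τ v).card : R) ≤ ∑ u ∈ lassoCycle o σ τ v, w u (positionalPlay o σ τ u)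

/-- **Min wins the mean-payoff threshold game from `v`, positionally** (dual, strict form): Min
has a legal positional strategy `τ` such that for every legal positional strategy `σ` of Max the
lasso cycle `C` from `v` has mean weight `< θ`, i.e. `∑_{u ∈ C} w u (f u) < θ · |C|`.
[cite: FijalkowEtAl2023GamesOnGraphs, Ch. 4 § "Mean payoff games" (Min ensures the threshold); originally EhrenfeuchtMycielski1979] -/
def MinWinsThresholdPositional [Semiring R] [LT R] (o : V → Bool) (w : V → V → R)
    (E : V → V → Prop) (v : V) (θ : R) : Prop :=
  ∃ τ : V → V, (∀ u, o u = false → E u (τ u)) ∧ ∀ σ : V → V, (∀ u, o u = true → E u (σ u)) →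
    ∑ u ∈ lassoCycle o σ τ v, w u (positionalPlay o σ τ u) < θ * ((lassoCycle o σ τ v).card : R)

/-- `MaxWinsThresholdPositional` unfolded to the shape inlined by route PneNP/PositionalGames
(general edge relation and weights); definitional. [folklore] -/
theorem maxWinsThresholdPositional_iff [Semiring R] [LE R] (o : V → Bool) (w : V → V → R)
    (E : V → V → Prop) (v : V) (θ : R) :
    MaxWinsThresholdPositional o w E v θ ↔
      ∃ σ : V → V, (∀ u, o u = true → E u (σ u)) ∧ ∀ τ : V → V,
        (∀ u, o u = false → E u (τ u)) →
          let C : Finset V := Finset.univ.filter fun u : V =>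
            ∃ᶠ t : ℕ in Filter.atTop, (fun w : V => if o w = true then σ w else τ w)^[t] v = u
          θ * (C.card : R) ≤ ∑ u ∈ C, w u (if o u = true then σ u else τ u) :=
  Iff.rfl

/-- **Monotonicity.** Max's winning predicate is monotone in Max's edges, antitone in Min's
edges, monotone in the weights and antitone in the threshold: enlarging `E` at Max's vertices,
shrinking it at Min's vertices, raising weights and lowering the threshold preserve a win (the
same strategy `σ` works; the lasso cycle depends only on `σ`, `τ`, `v`). [folklore] -/
theorem MaxWinsThresholdPositional.mono [Semiring R] [PartialOrder R] [IsOrderedRing R]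
    {o : V → Bool} {w w' : V → V → R} {E E' : V → V → Prop} {v : V} {θ θ' : R}
    (hMax : ∀ u u', o u = true → E u u' → E' u u')
    (hMin : ∀ u u', o u = false → E' u u' → E u u')
    (hw : ∀ u u', w u u' ≤ w' u u') (hθ : θ' ≤ θ) :
    MaxWinsThresholdPositional o w E v θ → MaxWinsThresholdPositional o w' E' v θ' := by
  rintro ⟨σ, hσ, hwin⟩
  refine ⟨σ, fun u hu => hMax u _ hu (hσ u hu), fun τ hτ => ?_⟩
  calc θ' * ((lassoCycle o σ τ v).card : R)
      ≤ θ * ((lassoCycle o σ τ v).card : R) := mul_le_mul_of_nonneg_right hθ (Nat.cast_nonneg _)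
    _ ≤ ∑ u ∈ lassoCycle o σ τ v, w u (positionalPlay o σ τ u) :=
        hwin τ fun u hu => hMin u _ hu (hτ u hu)
    _ ≤ ∑ u ∈ lassoCycle o σ τ v, w' u (positionalPlay o σ τ u) :=
        Finset.sum_le_sum fun u _ => hw u _

/-- The two players cannot both win the threshold game positionally ("at most one" half of
positional determinacy; elementary: play Max's `σ` against Min's `τ`). [folklore] -/
theorem MaxWinsThresholdPositional.not_minWins [Semiring R] [PartialOrder R]
    {o : V → Bool} {w : V → V → R} {E : V → V → Prop} {v : V} {θ : R}
    (hMax : MaxWinsThresholdPositional o w E v θ) (hMin : MinWinsThresholdPositional o w E v θ) :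
    False := by
  obtain ⟨σ, hσ, h₁⟩ := hMax
  obtain ⟨τ, hτ, h₂⟩ := hMin
  exact lt_irrefl _ (lt_of_le_of_lt (h₁ τ hτ) (h₂ σ hσ))

/-! ### The monotone Boolean encoding -/

section Bits

variable {k : ℕ}

omit [Fintype V] in
/-- Edge relation read off the input bits: one bit `Sum.inl (u, u')` per ordered pair; at a Max
vertex (`o u = true`) the edge `u → u'` is present iff the bit is `true`, at a Min vertex iff it
is `false` (Min's edge bits are complemented, which makes winning monotone in the input) — the
encoding `ParityGame.edgeOfBits` applied to the edge part of the input. [folklore] -/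
def bitEdge (o : V → Bool) (x : (V × V) ⊕ (V × Fin k) → Bool) : V → V → Prop :=
  ParityGame.edgeOfBits o fun e => x (Sum.inl e)

omit [Fintype V] in
/-- Unfolding `bitEdge`. [folklore] -/
@[simp] theorem bitEdge_apply (o : V → Bool) (x : (V × V) ⊕ (V × Fin k) → Bool) (u u' : V) :
    bitEdge o x u u' ↔ x (Sum.inl (u, u')) = o u := Iff.rfl

omit [Fintype V] in
/-- Vertex weight read off the input bits: `k` binary digits `Sum.inr (u, j)`, `j < k`; weight
`∑_j 2^j · [bit (u, j)] ∈ [0, 2^k)`. [folklore] -/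
def bitWeight (x : (V × V) ⊕ (V × Fin k) → Bool) (u : V) : ℕ :=
  ∑ j : Fin k, if x (Sum.inr (u, j)) = true then 2 ^ (j : ℕ) else 0

/-- `MPGWIN` as a proposition: Max wins the vertex-weighted mean-payoff threshold game from `v`
with threshold `θ` in the bit-encoded arena (`bitEdge`, `bitWeight`; the weight of an edge is the
weight of its source). [folklore] -/
def WinBits (o : V → Bool) (v : V) (θ : ℕ) (x : (V × V) ⊕ (V × Fin k) → Bool) : Prop :=
  MaxWinsThresholdPositional o (fun u _ => bitWeight x u) (bitEdge o x) v θ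

variable (k) in
/-- **MPGWIN**, the Boolean function of the input bits computed by the route's circuits:
`x ↦ [Max wins the encoded threshold game from v]`; the number `k` of weight digits is explicit.
[folklore] -/
noncomputable def winFn (o : V → Bool) (v : V) (θ : ℕ) : ((V × V) ⊕ (V × Fin k) → Bool) → Bool :=
  fun x => decide (WinBits o v θ x)

/-- Unfolding `winFn`. [folklore] -/
theorem winFn_apply (o : V → Bool) (v : V) (θ : ℕ) (x : (V × V) ⊕ (V × Fin k) → Bool) :
    winFn k o v θ x = decide (WinBits o v θ x) := rfl

omit [Fintype V] in
/-- Raising bits raises the encoded weights. [folklore] -/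
theorem bitWeight_mono {x y : (V × V) ⊕ (V × Fin k) → Bool} (h : x ≤ y) (u : V) :
    bitWeight x u ≤ bitWeight y u := by
  unfold bitWeight
  refine Finset.sum_le_sum fun j _ => ?_
  by_cases hx : x (Sum.inr (u, j)) = true
  · have hy : y (Sum.inr (u, j)) = true := Bool.le_iff_imp.1 (h (Sum.inr (u, j))) hx
    simp [hx, hy]
  · simp [hx]

/-- Raising bits preserves a win of Max (more Max edges, fewer Min edges, larger weights).
[folklore] -/
theorem WinBits.mono {o : V → Bool} {v : V} {θ : ℕ} {x y : (V × V) ⊕ (V × Fin k) → Bool}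
    (h : x ≤ y) : WinBits o v θ x → WinBits o v θ y := by
  refine MaxWinsThresholdPositional.mono ?_ ?_ (fun u _ => bitWeight_mono h u) le_rfl
  · intro u u' hu hx
    rw [bitEdge_apply, hu] at hx ⊢
    exact Bool.le_iff_imp.1 (h (Sum.inl (u, u'))) hx
  · intro u u' hu hy
    rw [bitEdge_apply, hu] at hy ⊢
    have hle := h (Sum.inl (u, u'))
    revert hle hy
    cases x (Sum.inl (u, u')) <;> cases y (Sum.inl (u, u')) <;> simp

/-- **Monotonicity of MPGWIN** in the input bits (pointwise order on `Bool`-valued inputs,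
`false < true`): Max-edge bits positive, Min-edge bits complemented, weight digits positive.
[folklore] -/
theorem winFn_monotone (o : V → Bool) (v : V) (θ : ℕ) : Monotone (winFn k o v θ) := by
  intro x y hxy
  simp only [winFn, Bool.le_iff_imp, decide_eq_true_eq]
  exact WinBits.mono hxy

/-- The same, for the function written as a `decide` lambda. [folklore] -/
theorem winBits_monotone (o : V → Bool) (v : V) (θ : ℕ) :
    Monotone fun x : (V × V) ⊕ (V × Fin k) → Bool => decide (WinBits o v θ x) :=
  winFn_monotone o v θ

end Bits

/-- `WinBits` spelled out for `V = Fin n` with `n` weight digits and threshold `2^(n-1)` ("mean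
weight ≥ 2^(n-1)", written `2^n · |C| ≤ 2 · ∑_{u ∈ C} w u`): the literal proposition inlined in
route PneNP/PositionalGames before this definition existed. [folklore] -/
theorem winBits_two_pow_iff (n : ℕ) (o : Fin n → Bool) (v : Fin n)
    (x : (Fin n × Fin n) ⊕ (Fin n × Fin n) → Bool) :
    WinBits o v (2 ^ (n - 1)) x ↔
      ∃ σ : Fin n → Fin n, (∀ u, o u = true → x (Sum.inl (u, σ u)) = true) ∧
        ∀ τ : Fin n → Fin n, (∀ u, o u = false → x (Sum.inl (u, τ u)) = false) →
          let C : Finset (Fin n) := Finset.univ.filter fun u : Fin n =>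
            ∃ᶠ t : ℕ in Filter.atTop, (fun w : Fin n => if o w = true then σ w else τ w)^[t] v = u
          2 ^ n * C.card ≤ 2 * ∑ u ∈ C, ∑ j : Fin n,
            if x (Sum.inr (u, j)) = true then 2 ^ (j : ℕ) else 0 := by
  cases n with
  | zero => exact v.elim0
  | succ m =>
    unfold WinBits MaxWinsThresholdPositional
    refine exists_congr fun σ => and_congr ?_ (forall_congr' fun τ => imp_congr ?_ ?_)
    · exact forall_congr' fun u => imp_congr_right fun hu => by rw [bitEdge_apply, hu]
    · exact forall_congr' fun u => imp_congr_right fun hu => by rw [bitEdge_apply, hu]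
    · show 2 ^ (m + 1 - 1) * ((lassoCycle o σ τ v).card : ℕ) ≤
          ∑ u ∈ lassoCycle o σ τ v, bitWeight x u ↔
          2 ^ (m + 1) * (lassoCycle o σ τ v).card ≤ 2 * ∑ u ∈ lassoCycle o σ τ v, bitWeight x u
      rw [Nat.add_sub_cancel,
        show 2 ^ (m + 1) * (lassoCycle o σ τ v).card = 2 * (2 ^ m * (lassoCycle o σ τ v).card)
          by ring]
      generalize 2 ^ m * (lassoCycle o σ τ v).card = a
      generalize ∑ u ∈ lassoCycle o σ τ v, bitWeight x u = b
      omega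

/-- **`winFn` is the route's function, literally (`V = Fin n`, `n` weight digits, threshold
`2^(n-1)`).** The right-hand side is the lambda that `MpgGeneralSuperpoly` /
`MpgMonotoneSuperpoly` / `MpgNoMonotoneGap` / `MpgHardNpLanguage` of
`Summit.PneNP.PneNP.Theses.PositionalGames` feed to `circuitSizeOver`, elaborated in the same
`open scoped Classical` context; those items restate over `winFn` by `simp only [winFn_eq_fin]`
(checked in a scratch file against verbatim copies of the route decls). [folklore] -/
theorem winFn_eq_fin (n : ℕ) (o : Fin n → Bool) (v : Fin n) :
    winFn n o v (2 ^ (n - 1)) = fun x : (Fin n × Fin n) ⊕ (Fin n × Fin n) → Bool => decide (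
      ∃ σ : Fin n → Fin n, (∀ u, o u = true → x (Sum.inl (u, σ u)) = true) ∧
        ∀ τ : Fin n → Fin n, (∀ u, o u = false → x (Sum.inl (u, τ u)) = false) →
          let C : Finset (Fin n) := Finset.univ.filter fun u : Fin n =>
            ∃ᶠ t : ℕ in Filter.atTop, (fun w : Fin n => if o w = true then σ w else τ w)^[t] v = u
          2 ^ n * C.card ≤ 2 * ∑ u ∈ C, ∑ j : Fin n,
            if x (Sum.inr (u, j)) = true then 2 ^ (j : ℕ) else 0) := by
  funext x
  exact (decide_eq_decide).2 (winBits_two_pow_iff n o v x)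

/-! ### Positional determinacy (named fact) -/

/-- **Positional determinacy of mean-payoff games, threshold form** (Ehrenfeucht–Mycielski
1979). On a finite arena in which every vertex has a successor, with integer edge weights, for
every start vertex `v` and every integer threshold `θ`: either Max has a positional strategy
forcing, against every positional strategy of Min, a lasso cycle of mean weight `≥ θ`, or Min has
a positional strategy forcing, against every positional strategy of Max, a lasso cycle of mean
weight `< θ` (and not both: `MaxWinsThresholdPositional.not_minWins`).

This is the restriction to positional counter-strategies and thresholds of the printed theorem
"mean payoff objectives are uniformly positionally determined over finite arenas" — for every
game with integer weights both players have positional optimal strategies `σ*`, `τ*`: every play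
consistent with `σ*` from `v` has mean payoff `≥ val(v)` and every play consistent with `τ*` has
mean payoff `≤ val(v)` — together with the remark that the play of two positional strategies is a
lasso whose mean payoff is the mean of its cycle: if `θ ≤ val(v)` take `σ*`, otherwise `τ*`.
Arenas there may have parallel edges; ours (an edge relation) are the special case without.
[cite: FijalkowEtAl2023GamesOnGraphs, Ch. 4 § "Proving positional determinacy over finite arenas", Cor. "Positional determinacy of mean payoff", with § "Mean payoff games", Cor. "Limit superior and limit inferior mean payoff games" (lasso plays, values are cycle means); originally EhrenfeuchtMycielski1979] -/
def EhrenfeuchtMycielski1979_thresholdDichotomy : Prop :=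
  ∀ (V : Type u) [Fintype V] (o : V → Bool) (w : V → V → ℤ) (E : V → V → Prop),
    (∀ u, ∃ u', E u u') → ∀ (v : V) (θ : ℤ),
      MaxWinsThresholdPositional o w E v θ ∨ MinWinsThresholdPositional o w E v θ

/-- From the named fact: on a dead-end-free finite arena Max wins the threshold game
positionally iff Min does not. [cite: FijalkowEtAl2023GamesOnGraphs, Ch. 4 § "Proving positional determinacy over finite arenas", Cor. "Positional determinacy of mean payoff"] -/
theorem EhrenfeuchtMycielski1979_thresholdDichotomy.maxWins_iff_not_minWins
    (hdet : EhrenfeuchtMycielski1979_thresholdDichotomy.{u}) (o : V → Bool) (w : V → V → ℤ)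
    (E : V → V → Prop) (hE : ∀ u, ∃ u', E u u') (v : V) (θ : ℤ) :
    MaxWinsThresholdPositional o w E v θ ↔ ¬ MinWinsThresholdPositional o w E v θ :=
  ⟨fun h h' => h.not_minWins h', fun h => (hdet V o w E hE v θ).resolve_right h⟩

end MeanPayoffGame

end Literature.Combinatorics.Games
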